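import Summits.HubbardSuperconductivity.HubbardSuperconductivity.Theorems.MesoscopicPairOrder.Negative.SaturatedExclusion

/-!
# Crux `MesoscopicPairOrder` (item `stmt-HubbardSuperconductivity-7331`), line `pointwise_split`:
# the saturated-ferromagnet exclusion transfers verbatim to the load-bearing stub (B) at its one scale

Negative-side support (lead c7). Stub (B) `stub_leakBeatingBlockPairSeed` of the registered skeleton
`Cruxes/MesoscopicPairOrder/Lines/pointwise_split.lean` asks, at SOME `(U, δ)`, for the crux body at ONE
block scale `R₀` with a margin `m₀` beating the leak of every background budget `(S, A)`; its budget-free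
form is super-linear block pair order `∀ C ∃ R₀ > 0 : C R₀ ≤ T_{R₀}(ψ)/L²`
(`Theorems.FunctionFieldCertificate.leakBeatingBlockPairSeed_iff_superlinear`). Both bodies are spelled
out verbatim at fixed `(U, δ)` below (no definition is introduced).

* `seedBody_false_of_saturated` — if saturated `(N_L, S^z = 0)`-sector ground states (`S² ψ = n(n+1) ψ`,
  `n = ⌊(1-δ)L²/2⌋`) occur along infinitely many even sides, the body of (B) fails at `(U, δ)`: at budget
  `S = A = 0` the stub must produce `R₀ > 0`, `m₀ > 0` and `L₀`; a saturated ground state beyond `L₀`,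
  normalised, is admissible and has `T_{R₀} = 0` (`boxSum_eq_zero_of_saturated`), so `m₀ R₀² ≤ 0`.
* `superlinearBody_false_of_saturated` — the same for the super-linear form (`C = 1` gives `R₀ ≤ 0`).
* `eventually_not_saturated_of_seedBody` — dually, at the witness `(U, δ)` of any proof of (B),
  eventually (along even sides) no sector ground state is a saturated ferromagnet.

So the disprover's one rigorous instrument against the crux (`pointwise_false_of_saturated`) is also the
one rigorous instrument against (B), with the same exclusion region; by
`NoSaturationWindowBoxes` / `NoSaturationEnvelope` that region misses `[0, 6] × [1/10, 3/10]`.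
Nothing here proves or refutes (B) or the crux. Sources: H. Tasaki, Prog. Theor. Phys. 99 (1998) 489,
p. 20; folklore. No definition, no named fact.
-/

noncomputable section

-- the summit namespace repeats the problem name by design (D-0017)
set_option linter.dupNamespace false

namespace Summit.HubbardSuperconductivity.HubbardSuperconductivity.Theorems.MesoscopicPairOrder.Negative

open Matrix Finset Filter
open Literature.Probability.LatticeModels Literature.MathematicalPhysics.QuantumLattice
open scoped ComplexOrder

/-- From a saturated sector ground state i.o. and a threshold `L₀`: an even side `L ≥ max L₀ 1` with a
NORMALISED saturated sector ground state (rescaling by `exists_smul_unit`), on which the Fejér-box pair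
functional vanishes at every scale. [folklore] -/
theorem exists_unit_saturated_groundState {U δ : ℝ}
    (hsat : ∃ᶠ L : ℕ in atTop, Even L ∧ ∃ ψ : Fock (Orb (FermionTorus 2 L)),
      IsGroundStateInSector (hubbardTorus 2 L 1 U) (2 * ⌊(1 - δ) * (L : ℝ) ^ 2 / 2⌋₊) 0 ψ ∧
        spinSq *ᵥ ψ = (((⌊(1 - δ) * (L : ℝ) ^ 2 / 2⌋₊ : ℝ) *
          ((⌊(1 - δ) * (L : ℝ) ^ 2 / 2⌋₊ : ℝ) + 1) : ℝ) : ℂ) • ψ)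
    (L₀ : ℕ) :
    ∃ (L : ℕ) (_ : NeZero L), L₀ ≤ L ∧ Even L ∧ ∃ ψ : Fock (Orb (FermionTorus 2 L)), star ψ ⬝ᵥ ψ = 1 ∧
      IsGroundStateInSector (hubbardTorus 2 L 1 U) (2 * ⌊(1 - δ) * (L : ℝ) ^ 2 / 2⌋₊) 0 ψ ∧
        ∀ R : ℕ, (∑ x : TorusSite 2 L, ∑ y : TorusSite 2 L,
          (∏ i : Fin 2, max 0 (1 - |(((y i - x i).valMinAbs : ℤ) : ℝ)| / (R : ℝ))) *
            (star (localPair dWaveFormFactor L x *ᵥ ψ) ⬝ᵥ (localPair dWaveFormFactor L y *ᵥ ψ)).re) = 0 := by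
  obtain ⟨L, ⟨hEven, ψ, hgs, hS⟩, hLge⟩ :=
    (hsat.and_eventually (eventually_ge_atTop (max L₀ 1))).exists
  have hL0 : L₀ ≤ L := le_of_max_le_left hLge
  have hL1 : 1 ≤ L := le_of_max_le_right hLge
  haveI : NeZero L := ⟨by omega⟩
  obtain ⟨c, hc, hc1⟩ := Literature.MathematicalPhysics.QuantumLattice.exists_smul_unit hgs.2.1
  have hgs' := Summit.HubbardSuperconductivity.NoGo.isGroundStateInSector_smul _ _ _ hgs hc
  have hN : IsNParticle (2 * ⌊(1 - δ) * (L : ℝ) ^ 2 / 2⌋₊) (c • ψ) :=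
    ((mem_szSector_iff _ _ _).1 hgs'.1).1
  have hSc : spinSq *ᵥ (c • ψ) = (((⌊(1 - δ) * (L : ℝ) ^ 2 / 2⌋₊ : ℝ) *
      ((⌊(1 - δ) * (L : ℝ) ^ 2 / 2⌋₊ : ℝ) + 1) : ℝ) : ℂ) • (c • ψ) := by
    rw [mulVec_smul, hS, smul_comm]
  exact ⟨L, inferInstance, hL0, hEven, c • ψ, hc1, hgs', fun R => boxSum_eq_zero_of_saturated L R hN hSc⟩

/-- **Exclusion for stub (B): the leak-beating block pair seed fails at every `(U, δ)` with saturated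
sector ground states along infinitely many even sides.** The body of `stub_leakBeatingBlockPairSeed`
at `(U, δ)` (verbatim), tested at the zero budget `S = A = 0`: the stub supplies `R₀ > 0`, `ε > 0`,
`m₀ > 32ε·0 + 0 = 0` and `L₀`; a normalised saturated ground state beyond `L₀` is admissible and has
`T_{R₀} = 0`, so `m₀ R₀² ≤ 0` — impossible. Hence the witness `(U, δ)` of any proof of (B) lies where
sector ground states are eventually NOT saturated ferromagnets (the same exclusion region as the crux's,
`pointwise_false_of_saturated`). [folklore] -/
theorem seedBody_false_of_saturated {U δ : ℝ}
    (hsat : ∃ᶠ L : ℕ in atTop, Even L ∧ ∃ ψ : Fock (Orb (FermionTorus 2 L)),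
      IsGroundStateInSector (hubbardTorus 2 L 1 U) (2 * ⌊(1 - δ) * (L : ℝ) ^ 2 / 2⌋₊) 0 ψ ∧
        spinSq *ᵥ ψ = (((⌊(1 - δ) * (L : ℝ) ^ 2 / 2⌋₊ : ℝ) *
          ((⌊(1 - δ) * (L : ℝ) ^ 2 / 2⌋₊ : ℝ) + 1) : ℝ) : ℂ) • ψ) :
    ¬ (∀ S A : ℝ, 0 ≤ S → 0 ≤ A →
      ∃ (R₀ : ℕ) (ε m₀ : ℝ), 0 < R₀ ∧ 0 < ε ∧
        32 * ε * (S * ε + A) + (S + A / ε) / (R₀ : ℝ) ^ 2 < m₀ ∧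
        ∃ L₀ : ℕ, ∀ (L : ℕ) [NeZero L], L₀ ≤ L → Even L →
          ∀ ψ : Fock (Orb (FermionTorus 2 L)), star ψ ⬝ᵥ ψ = 1 →
            IsGroundStateInSector (hubbardTorus 2 L 1 U) (2 * ⌊(1 - δ) * (L : ℝ) ^ 2 / 2⌋₊) 0 ψ →
              m₀ * (R₀ : ℝ) ^ 2 ≤ (∑ x : Fin 2 → ZMod L, ∑ y : Fin 2 → ZMod L,
                (∏ i : Fin 2, max 0 (1 - |(((y i - x i).valMinAbs : ℤ) : ℝ)| / (R₀ : ℝ))) *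
                  (star (Matrix.mulVec (localPair dWaveFormFactor L x) ψ) ⬝ᵥ
                    Matrix.mulVec (localPair dWaveFormFactor L y) ψ).re) / (L : ℝ) ^ 2) := by
  intro hB
  obtain ⟨R₀, ε, m₀, hR₀, hε, hleak, L₀, hL⟩ := hB 0 0 le_rfl le_rfl
  have hm₀ : 0 < m₀ := by
    have : 32 * ε * (0 * ε + 0) + (0 + 0 / ε) / (R₀ : ℝ) ^ 2 = 0 := by ring
    linarith
  obtain ⟨L, _, hL0, hEven, ψ, hψ1, hgs, hT⟩ := exists_unit_saturated_groundState hsat L₀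
  have hbad := hL L hL0 hEven ψ hψ1 hgs
  have hzero : (∑ x : Fin 2 → ZMod L, ∑ y : Fin 2 → ZMod L,
      (∏ i : Fin 2, max 0 (1 - |(((y i - x i).valMinAbs : ℤ) : ℝ)| / (R₀ : ℝ))) *
        (star (Matrix.mulVec (localPair dWaveFormFactor L x) ψ) ⬝ᵥ
          Matrix.mulVec (localPair dWaveFormFactor L y) ψ).re) = 0 := hT R₀
  rw [hzero, zero_div] at hbad
  have hR1 : (1 : ℝ) ≤ (R₀ : ℝ) := by exact_mod_cast hR₀
  have : 0 < m₀ * (R₀ : ℝ) ^ 2 := by positivity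
  linarith

/-- **Exclusion for the super-linear form of (B)** (`leakBeatingBlockPairSeed_iff_superlinear`, body at
`(U, δ)` verbatim): with saturated sector ground states i.o., `C = 1` would force `R₀ ≤ T_{R₀}/L² = 0`
on a normalised saturated ground state, contradicting `R₀ > 0`. [folklore] -/
theorem superlinearBody_false_of_saturated {U δ : ℝ}
    (hsat : ∃ᶠ L : ℕ in atTop, Even L ∧ ∃ ψ : Fock (Orb (FermionTorus 2 L)),
      IsGroundStateInSector (hubbardTorus 2 L 1 U) (2 * ⌊(1 - δ) * (L : ℝ) ^ 2 / 2⌋₊) 0 ψ ∧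
        spinSq *ᵥ ψ = (((⌊(1 - δ) * (L : ℝ) ^ 2 / 2⌋₊ : ℝ) *
          ((⌊(1 - δ) * (L : ℝ) ^ 2 / 2⌋₊ : ℝ) + 1) : ℝ) : ℂ) • ψ) :
    ¬ (∀ C : ℝ, ∃ R₀ : ℕ, 0 < R₀ ∧ ∃ L₀ : ℕ, ∀ (L : ℕ) [NeZero L], L₀ ≤ L → Even L →
      ∀ ψ : Fock (Orb (FermionTorus 2 L)), star ψ ⬝ᵥ ψ = 1 →
        IsGroundStateInSector (hubbardTorus 2 L 1 U) (2 * ⌊(1 - δ) * (L : ℝ) ^ 2 / 2⌋₊) 0 ψ →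
          C * (R₀ : ℝ) ≤ (∑ x : TorusSite 2 L, ∑ y : TorusSite 2 L,
            (∏ i : Fin 2, max 0 (1 - |(((y i - x i).valMinAbs : ℤ) : ℝ)| / (R₀ : ℝ))) *
              (star (localPair dWaveFormFactor L x *ᵥ ψ) ⬝ᵥ (localPair dWaveFormFactor L y *ᵥ ψ)).re) /
                (L : ℝ) ^ 2) := by
  intro hB
  obtain ⟨R₀, hR₀, L₀, hL⟩ := hB 1
  obtain ⟨L, _, hL0, hEven, ψ, hψ1, hgs, hT⟩ := exists_unit_saturated_groundState hsat L₀
  have hbad := hL L hL0 hEven ψ hψ1 hgs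
  rw [hT R₀, zero_div] at hbad
  have hR1 : (1 : ℝ) ≤ (R₀ : ℝ) := by exact_mod_cast hR₀
  linarith

/-- Dual form for stub (B): **at the witness `(U, δ)` of any proof of the leak-beating block pair seed,
eventually (along even sides) no `(N_L, S^z = 0)`-sector ground state is a saturated ferromagnet.**
[folklore] -/
theorem eventually_not_saturated_of_seedBody {U δ : ℝ}
    (h : ∀ S A : ℝ, 0 ≤ S → 0 ≤ A →
      ∃ (R₀ : ℕ) (ε m₀ : ℝ), 0 < R₀ ∧ 0 < ε ∧
        32 * ε * (S * ε + A) + (S + A / ε) / (R₀ : ℝ) ^ 2 < m₀ ∧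
        ∃ L₀ : ℕ, ∀ (L : ℕ) [NeZero L], L₀ ≤ L → Even L →
          ∀ ψ : Fock (Orb (FermionTorus 2 L)), star ψ ⬝ᵥ ψ = 1 →
            IsGroundStateInSector (hubbardTorus 2 L 1 U) (2 * ⌊(1 - δ) * (L : ℝ) ^ 2 / 2⌋₊) 0 ψ →
              m₀ * (R₀ : ℝ) ^ 2 ≤ (∑ x : Fin 2 → ZMod L, ∑ y : Fin 2 → ZMod L,
                (∏ i : Fin 2, max 0 (1 - |(((y i - x i).valMinAbs : ℤ) : ℝ)| / (R₀ : ℝ))) *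
                  (star (Matrix.mulVec (localPair dWaveFormFactor L x) ψ) ⬝ᵥ
                    Matrix.mulVec (localPair dWaveFormFactor L y) ψ).re) / (L : ℝ) ^ 2) :
    ∀ᶠ L : ℕ in atTop, Even L → ∀ ψ : Fock (Orb (FermionTorus 2 L)),
      IsGroundStateInSector (hubbardTorus 2 L 1 U) (2 * ⌊(1 - δ) * (L : ℝ) ^ 2 / 2⌋₊) 0 ψ →
        spinSq *ᵥ ψ ≠ (((⌊(1 - δ) * (L : ℝ) ^ 2 / 2⌋₊ : ℝ) *
          ((⌊(1 - δ) * (L : ℝ) ^ 2 / 2⌋₊ : ℝ) + 1) : ℝ) : ℂ) • ψ := by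
  have hns := mt (seedBody_false_of_saturated (U := U) (δ := δ)) (not_not.2 h)
  rw [Filter.not_frequently] at hns
  filter_upwards [hns] with L hL hE ψ hgs hS
  exact hL ⟨hE, ψ, hgs, hS⟩

end Summit.HubbardSuperconductivity.HubbardSuperconductivity.Theorems.MesoscopicPairOrder.Negative
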